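/-
Copyright (c) 2026. All rights reserved.
Released under Apache 2.0 license as described in the file LICENSE.
Authors: abc-iut cell, prover seat abc-iut-L4-t12 (gen 8).
-/
import Literature.AnabelianGeometry.AbsoluteAnabelian.ArchimedeanHolFieldFunctorGeometricPlaneComplTwist
import HarnessLib

/-!
# «Objects mapping to `X`» inside a downward-closed full subcategory; `EA^hol_RS(Q)` at `ℂ ∖ F`

PROOF-ONLY file (abc-iut cell, campaign-L item R1.2 of the `EA` column of [AbsTopIII] Prop 4.2 /
Cor 4.5).  S. Mochizuki, *Topics in Absolute Anabelian Geometry III*, proof of Prop 4.2 (i), kurims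
p.106 l.11–19: «for any object `X ∈ Ob(EA)` … the full subcategory of `EA` consisting of objects that map
to `X` … [is id-rigid]».  Here `EA = EA^hol_RS(Q) = Q.FullSubcategory` for an object property `Q` of
abc-iut-L4-t14's `HolRS` CLOSED UNDER FINITE ÉTALE COVERS (gen 7's `HolRS.IsCoverClosed`; e.g. the
hyperbolic connected Riemann surfaces).  For such `Q` the full subcategory «objects of `Q` mapping to
`X`» does not depend on `Q`:

* `ObjectProperty.mapsToι`, `mapsToι_full`, `_faithful`, `_essSurj`,
  **`isIdRigid_mapsTo_fullSubcategory_iff`** (any category `C`, any downward-closed `P`,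
  `X : P.FullSubcategory`): `{Y : P.FullSubcategory | Nonempty (Y ⟶ X)} ≌ {Z : C | Nonempty (Z ⟶ X.obj)}`
  (forget the property; every `Z ⟶ X.obj` forces `P Z`), so one is id-rigid iff the other is;
* **`HolRS.isIdRigid_mapsTo_fullSubcategory_planeComplFinite`**,
  **`HolRS.isIdRigid_mapsTo_planeComplFinite_of_two_le`** — for every cover-closed `Q ∋ ℂ ∖ F`, `F`
  finite with `2 ≤ |F|`: «objects of `EA^hol_RS(Q)` mapping to `ℂ ∖ F`» is id-rigid, UNCONDITIONALLY
  — gen 7's `isIdRigid_mapsTo_planeComplFinite_of` with its hypothesis (H1) REPLACED by the theorem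
  (H1′) of `ArchimedeanHolFieldFunctorGeometricPlaneComplTwist` (note: (H1) itself can fail for
  `|F| ≥ 3`).

HONEST SCOPE: model level; orbicurves, uniformisation, Lemma 4.3 untouched; nothing here bears on
[IUTchIII] Cor. 3.12; model ≠ reconstruction; support library, not a node.  One packaging `def` (the
forgetful functor `mapsToι`); no instances, no Prop facts.

## References

* S. Mochizuki, *Topics in Absolute Anabelian Geometry III*, kurims ms, proof of Prop 4.2 (i) p.106
  l.11–19; Section 0 p.27 (full subcategories). [MochizukiAbsTopIII2015]
-/

noncomputable section

open CategoryTheory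

namespace Literature.AnabelianGeometry.AbsoluteAnabelian

universe v u

/-! ### §1 «Objects mapping to `X`» does not see a downward-closed ambient property -/

section MapsToTransport

variable {C : Type u} [Category.{v} C] (P : ObjectProperty C)
  (hP : ∀ {Y Z : C}, (Y ⟶ Z) → P Z → P Y) (X : P.FullSubcategory)

/-- **Forgetting the property**: the functor from «objects of `P.FullSubcategory` mapping to `X`» to
«objects of `C` mapping to `X.obj`». [cite: MochizukiAbsTopIII2015, Section 0 p.27] -/
def ObjectProperty.mapsToι :
    (ObjectProperty.FullSubcategory fun Y : P.FullSubcategory => Nonempty (Y ⟶ X)) ⥤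
      ObjectProperty.FullSubcategory fun Z : C => Nonempty (Z ⟶ X.obj) where
  obj Y := ⟨Y.obj.obj, Y.property.map fun f => f.hom⟩
  map g := ObjectProperty.homMk g.hom.hom

/-- `mapsToι` is faithful. [cite: MochizukiAbsTopIII2015, Section 0 p.27] -/
theorem ObjectProperty.mapsToι_faithful : (ObjectProperty.mapsToι P X).Faithful where
  map_injective {_ _} g g' h := by
    have h' := congrArg InducedCategory.Hom.hom h
    apply ObjectProperty.hom_ext
    apply ObjectProperty.hom_ext
    exact h'

/-- `mapsToι` is full (both subcategories are full in `C`). [cite: MochizukiAbsTopIII2015, Section 0 p.27] -/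
theorem ObjectProperty.mapsToι_full : (ObjectProperty.mapsToι P X).Full where
  map_surjective {_ _} k := ⟨ObjectProperty.homMk (ObjectProperty.homMk k.hom), rfl⟩

include hP in
/-- `mapsToι` is essentially surjective when `P` is downward closed: an object `Z` of `C` with a
morphism `Z ⟶ X.obj` satisfies `P`. [cite: MochizukiAbsTopIII2015, Section 0 p.27] -/
theorem ObjectProperty.mapsToι_essSurj : (ObjectProperty.mapsToι P X).EssSurj where
  mem_essImage Z := by
    obtain ⟨f⟩ := Z.property
    exact ⟨⟨⟨Z.obj, hP f X.property⟩, ⟨ObjectProperty.homMk f⟩⟩, ⟨Iso.refl _⟩⟩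

include hP in
/-- `mapsToι` is an equivalence of categories. [cite: MochizukiAbsTopIII2015, Section 0 p.27] -/
theorem ObjectProperty.mapsToι_isEquivalence : (ObjectProperty.mapsToι P X).IsEquivalence :=
  haveI := ObjectProperty.mapsToι_faithful P X
  haveI := ObjectProperty.mapsToι_full P X
  haveI := ObjectProperty.mapsToι_essSurj P hP X
  Functor.IsEquivalence.mk

include hP in
/-- **«Objects of `P.FullSubcategory` mapping to `X`» is id-rigid iff «objects of `C` mapping to
`X.obj`» is**, for `P` downward closed. [cite: MochizukiAbsTopIII2015, Proposition 4.2 (i) p.106] -/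
theorem isIdRigid_mapsTo_fullSubcategory_iff :
    IsIdRigid (ObjectProperty.FullSubcategory fun Y : P.FullSubcategory => Nonempty (Y ⟶ X)) ↔
      IsIdRigid (ObjectProperty.FullSubcategory fun Z : C => Nonempty (Z ⟶ X.obj)) :=
  haveI := ObjectProperty.mapsToι_isEquivalence P hP X
  isIdRigid_iff_of_equivalence_univ (ObjectProperty.mapsToι P X).asEquivalence

end MapsToTransport

/-! ### §2 `EA^hol_RS(Q)` at `ℂ ∖ F` -/

namespace HolRS

variable {F : Set ℂ} (hF : F.Finite)

/-- **«Objects of `EA^hol_RS(Q)` mapping to `ℂ ∖ F`» is id-rigid — UNCONDITIONALLY**, for every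
`Q ⊆ HolRS` closed under finite étale covers with `ℂ ∖ F ∈ Q`, `F` finite with two distinct points:
gen 7's `isIdRigid_mapsTo_planeComplFinite_of` with (H1) replaced by the theorem (H1′)
(`planeComplFinite_twist_eq_id`), transported from `HolRS` into `Q.FullSubcategory` by
`isIdRigid_mapsTo_fullSubcategory_iff`. [cite: MochizukiAbsTopIII2015, Proposition 4.2 (i) p.106] -/
theorem isIdRigid_mapsTo_fullSubcategory_planeComplFinite (Q : ObjectProperty HolRS)
    (hQ : IsCoverClosed Q) {p₁ p₂ : ℂ} (hp₁ : p₁ ∈ F) (hp₂ : p₂ ∈ F) (hp : p₁ ≠ p₂)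
    (hXQ : Q (planeComplFinite F hF)) :
    IsIdRigid (ObjectProperty.FullSubcategory fun Y : Q.FullSubcategory =>
      Nonempty (Y ⟶ ⟨planeComplFinite F hF, hXQ⟩)) :=
  (isIdRigid_mapsTo_fullSubcategory_iff Q hQ ⟨planeComplFinite F hF, hXQ⟩).2
    (isIdRigid_mapsTo_planeComplFinite hF hp₁ hp₂ hp)

/-- The same with the hypothesis `2 ≤ |F|` in the shape of gen 7's `isIdRigid_mapsTo_planeComplFinite_of`
— whose input (H1) is hereby dispensed with. [cite: MochizukiAbsTopIII2015, Proposition 4.2 (i) p.106] -/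
theorem isIdRigid_mapsTo_planeComplFinite_of_two_le (Q : ObjectProperty HolRS) (hQ : IsCoverClosed Q)
    (h2 : 2 ≤ F.ncard) (hXQ : Q (planeComplFinite F hF)) :
    IsIdRigid (ObjectProperty.FullSubcategory fun Y : Q.FullSubcategory =>
      Nonempty (Y ⟶ ⟨planeComplFinite F hF, hXQ⟩)) := by
  obtain ⟨p₁, p₂, hp₁, hp₂, hp⟩ := (Set.one_lt_ncard_iff hF).mp h2
  exact isIdRigid_mapsTo_fullSubcategory_planeComplFinite hF Q hQ hp₁ hp₂ hp hXQ

/-- In particular for `Q = ⊤`: «objects of `HolRS` mapping to `ℂ ∖ F`», as a full subcategory of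
`(⊤ : ObjectProperty HolRS).FullSubcategory = EA^hol_RS(⊤)`, is id-rigid (`2 ≤ |F| < ∞`).
[cite: MochizukiAbsTopIII2015, Proposition 4.2 (i) p.106] -/
theorem isIdRigid_mapsTo_planeComplFinite_top (h2 : 2 ≤ F.ncard) :
    IsIdRigid (ObjectProperty.FullSubcategory fun Y : (⊤ : ObjectProperty HolRS).FullSubcategory =>
      Nonempty (Y ⟶ ⟨planeComplFinite F hF, trivial⟩)) :=
  isIdRigid_mapsTo_planeComplFinite_of_two_le hF ⊤ isCoverClosed_top h2 trivial

end HolRS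

end Literature.AnabelianGeometry.AbsoluteAnabelian
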